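import Mathlib
import Summits.MatrixMultiplication.MatrixMultiplication.Theses.MatrixPointInterpolation
import Summits.MatrixMultiplication.MatrixMultiplication.Theorems.MatrixPointInterpolationPointCount

/-!
# Line `many-letters` for crux `FewPointMasquerades` (route MatrixPointInterpolation)

Strategist line 2 (crux-strategist, 2026-08-17).  TRANSFER lens at crux level: move the open core
from "2 letters, point size k → ∞" to "m letters → ∞ at ANY fixed PI-class k" by an
ALPHABET REDUCTION (a deterministic block-code automaton realised by partial-permutation block
matrices: m letters ↦ 2 letters, sizes `× S(m)`, SAME number of points, window factor exactly 2).

  stub_fastMasqueradesMulti   (open core)  m-letter tuples generating M_n in degree d and satisfying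
                                           all m-letter identities of M_k up to degree D ≥ 2d + C,
                                           at speed D^((m-1)k²+1) ≤ n^(2+θ);
  stub_genericGrowthUpperMulti (literature) words of length ≤ D in m generic k×k matrices span
                                           ≤ K·D^((m-1)k²+1) dimensions (GKdim (m-1)k²+1, Procesi);
  pointCountMulti             (PROVED here) m-letter PointCount (port of `pointCount_proof`);
  stub_alphabetReduction      (combinatorial, believed routine) m letters ↦ 2 letters;
  FewPointMasquerades_of'     (PROVED)      composition, concluding the crux by name.
-/

set_option linter.dupNamespace false

namespace Summit.MatrixMultiplication.MatrixMultiplication.Cruxes.FewPointMasquerades.ManyLetters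

open scoped BigOperators
open Summit.MatrixMultiplication.MatrixMultiplication.Theses.MatrixPointInterpolation (FewPointMasquerades)

/-- `GenM m n d A`: the words of length `≤ d` in the `m`-tuple `A` span `M_n(ℂ)` (for `m = 2` this is
verbatim the generation conjunct of the crux). -/
def GenM (m n d : ℕ) (A : Fin m → Matrix (Fin n) (Fin n) ℂ) : Prop :=
  Submodule.span ℂ {M : Matrix (Fin n) (Fin n) ℂ |
    ∃ w : List (Fin m), w.length ≤ d ∧ (w.map A).prod = M} = ⊤

/-- `MasqM m n k D A`: every combination of `m`-letter words of length `≤ D` vanishing on all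
`m`-tuples of `k × k` matrices vanishes at `A`. -/
def MasqM (m n k D : ℕ) (A : Fin m → Matrix (Fin n) (Fin n) ℂ) : Prop :=
  ∀ (T : Finset (List (Fin m))) (c : List (Fin m) → ℂ), (∀ w ∈ T, w.length ≤ D) →
    (∀ B : Fin m → Matrix (Fin k) (Fin k) ℂ, (∑ w ∈ T, c w • (w.map B).prod) = 0) →
    (∑ w ∈ T, c w • (w.map A).prod) = 0

/-- `ShadowM m n k N D A B`: every combination of `m`-letter words of length `≤ D` vanishing at the
`N` points `B t` vanishes at `A` (for `m = 2`, `D = 2d` verbatim the last conjunct of the crux). -/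
def ShadowM (m n k N D : ℕ) (A : Fin m → Matrix (Fin n) (Fin n) ℂ)
    (B : Fin N → Fin m → Matrix (Fin k) (Fin k) ℂ) : Prop :=
  ∀ (T : Finset (List (Fin m))) (c : List (Fin m) → ℂ), (∀ w ∈ T, w.length ≤ D) →
    (∀ t : Fin N, (∑ w ∈ T, c w • (w.map (B t)).prod) = 0) →
    (∑ w ∈ T, c w • (w.map A).prod) = 0

/-- `wordDimMulti m k D`: dimension of the span of the word functions of length `≤ D` on `m`-tuples
of `k × k` matrices = `dim` of the degree-`≤ D` part of the algebra of `m` generic `k × k` matrices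
(`genericWordDim k D` is the case `m = 2`). -/
noncomputable def wordDimMulti (m k D : ℕ) : ℕ :=
  Module.finrank ℂ (Submodule.span ℂ {f : (Fin m → Matrix (Fin k) (Fin k) ℂ) →
    Matrix (Fin k) (Fin k) ℂ | ∃ w : List (Fin m), w.length ≤ D ∧ f = fun B => (w.map B).prod})

/-- **STUB 1 — FAST MASQUERADES, MANY LETTERS** (hardest; the open core).  For every `θ > 0` there
are an alphabet size `m ≥ 1` and a point size `k ≥ 1` such that for every slack `C` and every `n₀`
some `m`-tuple `A ∈ M_n(ℂ)^m`, `n ≥ n₀`, generates `M_n` in degree `d` and satisfies every `m`-letter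
identity of `M_k` of degree `≤ D`, for some window `D ≥ 2d + C`, at speed `D^((m-1)k²+1) ≤ n^(2+θ)`.
(`(m-1)k² + 1` = GK-dimension of `m` generic `k × k` matrices; the sharp anti-Riemann–Roch count
forces `θ ≥ 2/((m-1)k²)`, so EITHER `m` or `k` must grow as `θ → 0` — the line lets `m` grow at
fixed `k`, e.g. `k = 3` where the trace ring and the T-ideal are explicitly known.)
Why it might fail: a masquerade speed limit `ℓ(A) ≥ n^c` uniform in the number of letters.
No `m`-letter masquerade with `d = o(n)` is known.  Size XL. -/
theorem stub_fastMasqueradesMulti :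
    ∀ θ : ℝ, 0 < θ → ∃ m k : ℕ, 1 ≤ m ∧ 1 ≤ k ∧ ∀ C n₀ : ℕ,
      ∃ (n d D : ℕ) (A : Fin m → Matrix (Fin n) (Fin n) ℂ),
        n₀ ≤ n ∧ GenM m n d A ∧ MasqM m n k D A ∧ 2 * d + C ≤ D ∧
        ((D : ℝ)) ^ ((m - 1) * k ^ 2 + 1) ≤ (n : ℝ) ^ ((2 : ℝ) + θ) := by
  sorry

/-- **STUB 2 — GENERIC GROWTH, UPPER BOUND, MANY LETTERS** (literature, L).  The degree-`≤ D` part of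
the algebra of `m` generic `k × k` matrices has dimension `≤ K·D^((m-1)k²+1)` (`D ≥ 1`): its
GK-dimension is `(m-1)k² + 1` (Procesi 1967; Kanel-Belov–Karasik–Rowen 2015 p. 355, p. 367 Case 1)
and its Hilbert series is rational with poles at roots of unity (trace ring finite over a finitely
generated commutative ring: Formanek, Berele), whence quasi-polynomial growth. -/
theorem stub_genericGrowthUpperMulti :
    ∀ m k : ℕ, 1 ≤ m → 1 ≤ k → ∃ K : ℝ, 0 < K ∧ ∀ D : ℕ, 1 ≤ D →
      (wordDimMulti m k D : ℝ) ≤ K * (D : ℝ) ^ ((m - 1) * k ^ 2 + 1) := by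
  sorry

/-- **STUB 3 — ALPHABET REDUCTION** (combinatorial; believed routine, L).  For every alphabet size
`m ≥ 1` there are a state count `S ≥ 1` and a slack `C` such that any `m`-letter datum (tuple `A`
generating `M_n` in degree `d`, `N` points of size `k` shadowing it on a window `D ≥ 2d + C`) yields a
TWO-letter datum with the SAME `N` points, sizes `n' ≥ n` and `S·k`, generating in some degree `d'`
and shadowed on the window `2d'`.  Construction: WLOG every `A i` invertible (replace `A i, B t i` by
`A i + λᵢ•1, B t i + λᵢ•1`: the degree filtration and the shadow are invariant); encode letter `i` by
the block code word `X^i Y X^(m-i)` of fixed length `m + 1`, read by a deterministic automaton with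
`S = m + m(m+1)/2` states (emission of `A i` delayed to the end of its segment); `X', Y'` are the
`S × S` block matrices of the transitions with blocks `1` / `A i`.  Every two-letter word then has
blocks `[δ(q,w) = p]·u_{w,q}(A)` for ONE decoded `m`-word `u_{w,q}` of length `≤ |w|/(m+1) + 1`,
uniformly in `A` — so shadows transfer point by point — and strong connectivity plus invertibility of
the forced boundary letters give generation in degree `d' = (m+1)(d+2)`. -/
theorem stub_alphabetReduction :
    ∀ m : ℕ, 1 ≤ m → ∃ S C : ℕ, 1 ≤ S ∧
      ∀ (n k N d D : ℕ) (A : Fin m → Matrix (Fin n) (Fin n) ℂ)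
        (B : Fin N → Fin m → Matrix (Fin k) (Fin k) ℂ),
        GenM m n d A → ShadowM m n k N D A B → 2 * d + C ≤ D →
        ∃ (n' d' : ℕ) (A' : Fin 2 → Matrix (Fin n') (Fin n') ℂ)
          (B' : Fin N → Fin 2 → Matrix (Fin (S * k)) (Fin (S * k)) ℂ),
          n ≤ n' ∧ GenM 2 n' d' A' ∧ ShadowM 2 n' (S * k) N (2 * d') A' B' := by
  sorry

/-- **m-letter PointCount** (PROVED; port of `Theorems.pointCount_proof`): a tuple satisfying the
`m`-letter identities of `M_k` up to degree `D` is shadowed on the window `D` by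
`N ≤ wordDimMulti m k D` points (evaluation points at which the word-function span embeds). -/
theorem pointCountMulti (m n k D : ℕ) (A : Fin m → Matrix (Fin n) (Fin n) ℂ)
    (hA : MasqM m n k D A) :
    ∃ (N : ℕ) (B : Fin N → Fin m → Matrix (Fin k) (Fin k) ℂ),
      N ≤ wordDimMulti m k D ∧ ShadowM m n k N D A B := by
  have hSfin : {f : (Fin m → Matrix (Fin k) (Fin k) ℂ) → Matrix (Fin k) (Fin k) ℂ |
      ∃ w : List (Fin m), w.length ≤ D ∧ f = fun B => (w.map B).prod}.Finite := by
    refine ((List.finite_length_le (Fin m) D).image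
      (fun w : List (Fin m) => fun B : Fin m → Matrix (Fin k) (Fin k) ℂ => (w.map B).prod)).subset
      ?_
    rintro f ⟨w, hw, rfl⟩
    exact ⟨w, hw, rfl⟩
  haveI := FiniteDimensional.span_of_finite ℂ hSfin
  obtain ⟨N, B, hN, hB⟩ :=
    Summit.MatrixMultiplication.MatrixMultiplication.Theorems.exists_eval_points (Submodule.span ℂ
      {f : (Fin m → Matrix (Fin k) (Fin k) ℂ) → Matrix (Fin k) (Fin k) ℂ |
        ∃ w : List (Fin m), w.length ≤ D ∧ f = fun B => (w.map B).prod})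
  refine ⟨N, B, hN, fun T c hT hz => hA T c hT fun B' => ?_⟩
  have hF : (∑ w ∈ T, c w • fun B : Fin m → Matrix (Fin k) (Fin k) ℂ => (w.map B).prod) ∈
      Submodule.span ℂ {f : (Fin m → Matrix (Fin k) (Fin k) ℂ) → Matrix (Fin k) (Fin k) ℂ |
        ∃ w : List (Fin m), w.length ≤ D ∧ f = fun B => (w.map B).prod} :=
    Submodule.sum_mem _ fun w hw =>
      Submodule.smul_mem _ _ (Submodule.subset_span ⟨w, hT w hw, rfl⟩)
  have h0 := hB _ hF fun t => by simpa [Finset.sum_apply, Pi.smul_apply] using hz t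
  simpa [Finset.sum_apply, Pi.smul_apply] using congrFun h0 B'

/-- **Composition** (sorry-free): stubs 1–3 imply the crux `FewPointMasquerades` BY NAME.
`θ = ε/2`; alphabet/point sizes `m, k` from stub 1; `S, C` from stub 3; growth constant `K` from
stub 2; slack `max C 1` (so `D ≥ 1`); threshold `n ≥ ⌈K^(2/ε)⌉ + 1` (so `K ≤ n^(ε/2)`); then
`N ≤ wordDimMulti ≤ K·D^g ≤ K·n^(2+ε/2) ≤ n^(2+ε) ≤ n'^(2+ε)`. -/
theorem FewPointMasquerades_of'
    (hFast : ∀ θ : ℝ, 0 < θ → ∃ m k : ℕ, 1 ≤ m ∧ 1 ≤ k ∧ ∀ C n₀ : ℕ,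
      ∃ (n d D : ℕ) (A : Fin m → Matrix (Fin n) (Fin n) ℂ),
        n₀ ≤ n ∧ GenM m n d A ∧ MasqM m n k D A ∧ 2 * d + C ≤ D ∧
        ((D : ℝ)) ^ ((m - 1) * k ^ 2 + 1) ≤ (n : ℝ) ^ ((2 : ℝ) + θ))
    (hGrowth : ∀ m k : ℕ, 1 ≤ m → 1 ≤ k → ∃ K : ℝ, 0 < K ∧ ∀ D : ℕ, 1 ≤ D →
      (wordDimMulti m k D : ℝ) ≤ K * (D : ℝ) ^ ((m - 1) * k ^ 2 + 1))
    (hAR : ∀ m : ℕ, 1 ≤ m → ∃ S C : ℕ, 1 ≤ S ∧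
      ∀ (n k N d D : ℕ) (A : Fin m → Matrix (Fin n) (Fin n) ℂ)
        (B : Fin N → Fin m → Matrix (Fin k) (Fin k) ℂ),
        GenM m n d A → ShadowM m n k N D A B → 2 * d + C ≤ D →
        ∃ (n' d' : ℕ) (A' : Fin 2 → Matrix (Fin n') (Fin n') ℂ)
          (B' : Fin N → Fin 2 → Matrix (Fin (S * k)) (Fin (S * k)) ℂ),
          n ≤ n' ∧ GenM 2 n' d' A' ∧ ShadowM 2 n' (S * k) N (2 * d') A' B') :
    FewPointMasquerades := by
  intro ε hε
  obtain ⟨m, k, hm, hk, hfam⟩ := hFast (ε / 2) (by linarith)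
  obtain ⟨S, C, hS, hred⟩ := hAR m hm
  obtain ⟨K, hK0, hK⟩ := hGrowth m k hm hk
  refine ⟨S * k, fun n₀ => ?_⟩
  set n₁ : ℕ := ⌈K ^ (ε / 2)⁻¹⌉₊ + 1 with hn₁
  obtain ⟨n, d, D, A, hn, hGen, hMasq, hDd, hSpeed⟩ := hfam (max C 1) (max n₀ n₁)
  have hn₀ : n₀ ≤ n := le_trans (le_max_left _ _) hn
  have hnn₁ : n₁ ≤ n := le_trans (le_max_right _ _) hn
  have hD1 : 1 ≤ D := le_trans (le_trans (le_max_right C 1) (Nat.le_add_left _ _)) hDd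
  have hDC : 2 * d + C ≤ D := le_trans (Nat.add_le_add_left (le_max_left C 1) _) hDd
  -- points for the m-letter datum, then alphabet reduction
  obtain ⟨N, B, hN, hSh⟩ := pointCountMulti m n k D A hMasq
  obtain ⟨n', d', A', B', hnn', hGen', hSh'⟩ := hred n k N d D A B hGen hSh hDC
  refine ⟨n', d', N, A', B', le_trans hn₀ hnn', ?_, hGen', hSh'⟩
  -- real bookkeeping
  have hn1 : (1 : ℝ) ≤ (n : ℝ) := by
    have : 1 ≤ n := le_trans (by omega) hnn₁
    exact_mod_cast this
  have hnpos : (0 : ℝ) < (n : ℝ) := by linarith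
  have hnn'r : (n : ℝ) ≤ (n' : ℝ) := by exact_mod_cast hnn'
  have hNle : (N : ℝ) ≤ (wordDimMulti m k D : ℝ) := by exact_mod_cast hN
  have hW : (wordDimMulti m k D : ℝ) ≤ K * (D : ℝ) ^ ((m - 1) * k ^ 2 + 1) := hK D hD1
  have hKn : K ≤ (n : ℝ) ^ (ε / 2) := by
    have hε2 : (0 : ℝ) < ε / 2 := by linarith
    have hKr : (0 : ℝ) ≤ K ^ (ε / 2)⁻¹ := Real.rpow_nonneg hK0.le _
    have hceil : K ^ (ε / 2)⁻¹ ≤ (n : ℝ) := by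
      have h1 : K ^ (ε / 2)⁻¹ ≤ (⌈K ^ (ε / 2)⁻¹⌉₊ : ℝ) := Nat.le_ceil _
      have h2 : ((⌈K ^ (ε / 2)⁻¹⌉₊ : ℕ) : ℝ) ≤ (n : ℝ) := by
        have : ⌈K ^ (ε / 2)⁻¹⌉₊ ≤ n := by omega
        exact_mod_cast this
      linarith
    calc K = (K ^ (ε / 2)⁻¹) ^ (ε / 2) := (Real.rpow_inv_rpow hK0.le hε2.ne').symm
      _ ≤ (n : ℝ) ^ (ε / 2) := Real.rpow_le_rpow hKr hceil hε2.le
  have hsplit : (n : ℝ) ^ ((2 : ℝ) + ε) = (n : ℝ) ^ (ε / 2) * (n : ℝ) ^ ((2 : ℝ) + ε / 2) := by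
    rw [← Real.rpow_add hnpos]; congr 1; ring
  have hmono : (n : ℝ) ^ ((2 : ℝ) + ε) ≤ (n' : ℝ) ^ ((2 : ℝ) + ε) :=
    Real.rpow_le_rpow hnpos.le hnn'r (by linarith)
  calc (N : ℝ) ≤ (wordDimMulti m k D : ℝ) := hNle
    _ ≤ K * (D : ℝ) ^ ((m - 1) * k ^ 2 + 1) := hW
    _ ≤ K * (n : ℝ) ^ ((2 : ℝ) + ε / 2) := mul_le_mul_of_nonneg_left hSpeed hK0.le
    _ ≤ (n : ℝ) ^ (ε / 2) * (n : ℝ) ^ ((2 : ℝ) + ε / 2) :=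
        mul_le_mul_of_nonneg_right hKn (by positivity)
    _ = (n : ℝ) ^ ((2 : ℝ) + ε) := hsplit.symm
    _ ≤ (n' : ℝ) ^ ((2 : ℝ) + ε) := hmono

/-- The registered skeleton: the three stubs imply the crux by name. -/
theorem FewPointMasquerades_of_stubs' : FewPointMasquerades :=
  FewPointMasquerades_of' stub_fastMasqueradesMulti stub_genericGrowthUpperMulti stub_alphabetReduction

end Summit.MatrixMultiplication.MatrixMultiplication.Cruxes.FewPointMasquerades.ManyLetters
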